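import Summits.Ventures.YMGap.Thresholds.LatticeBakryEmeryIntegration
import HarnessLib

/-!
# Venture YMGap — multi-link Bakry–Émery calculus, Part E:
# Cauchy–Schwarz and the Poincaré inequality from approximate solvability of the Poisson equation

HONEST FRAMING: venture file (cell `pub-ymgap`, track (a), seat p2); the duality step of the kernel
proof of the multi-link Bakry–Émery Poincaré inequality on `SU(N)^E`, copied from the one-link tree
file `SUNBakryEmeryPoincare.lean` Part E with `SU(N)` replaced by `SU(N)^E` and the one-link
curvature constant `N/2 - |c|‖B‖_op` replaced by `K = N/2 - Λ` under the Hessian hypothesis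
`HessBound S Λ`.

Main result `poincare_of_approx`: for smooth `S` with `HessBound S Λ`, `K = N/2 - Λ > 0`, smooth `u`,
a constant `m`, and smooth `v_k` with `∫ e^S (L_S v_k - (u - m))² dσ^{⊗E} → 0`:
`K ∫ e^S (u - m)² dσ^{⊗E} ≤ ∫ e^S Γ(u,u) dσ^{⊗E}`.

## References

* D. Bakry, I. Gentil, M. Ledoux, Grundlehren 348 (2014), Prop. 4.8.1 (`CD(K,∞) ⇒ Poincaré(1/K)`).
* Tree file `SUNBakryEmeryPoincare.lean`, Part E.
-/

noncomputable section

open scoped Matrix ComplexConjugate BigOperators Matrix.Norms.Frobenius ContDiff Topology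
open Matrix Complex Finset MeasureTheory Filter
open Literature.MathematicalPhysics.QuantumFieldTheory

namespace Summit.Ventures.YMGap

namespace LatticeBakryEmery

universe u

variable {ι : Type u} [Fintype ι] [DecidableEq ι] {N : ℕ}

omit [DecidableEq ι] in
/-- **Cauchy–Schwarz** for integrals of continuous functions on `SU(N)^E`:
`|∫ f g| ≤ (∫ f²)^{1/2} (∫ g²)^{1/2}`. -/
theorem abs_integral_mul_le_sqrt {f g : PSU ι N → ℝ} (hf : Continuous f) (hg : Continuous g)
    (μ : Measure (PSU ι N)) [IsFiniteMeasure μ] :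
    |∫ x, f x * g x ∂μ| ≤ Real.sqrt (∫ x, f x ^ 2 ∂μ) * Real.sqrt (∫ x, g x ^ 2 ∂μ) := by
  set A := ∫ x, f x ^ 2 ∂μ with hA
  set Bi := ∫ x, g x ^ 2 ∂μ with hB
  have hA0 : 0 ≤ A := integral_nonneg fun x => sq_nonneg _
  have hB0 : 0 ≤ Bi := integral_nonneg fun x => sq_nonneg _
  have hfi : Integrable (fun x => f x ^ 2) μ := integrable_of_continuous_PSU (hf.pow 2) μ
  have hgi : Integrable (fun x => g x ^ 2) μ := integrable_of_continuous_PSU (hg.pow 2) μ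
  have hfgi : Integrable (fun x => f x * g x) μ := integrable_of_continuous_PSU (hf.mul hg) μ
  have hamgm : ∀ t : ℝ, 0 < t → 2 * |∫ x, f x * g x ∂μ| ≤ t * A + Bi / t := by
    intro t ht
    calc 2 * |∫ x, f x * g x ∂μ| ≤ 2 * ∫ x, |f x * g x| ∂μ := by
          have := abs_integral_le_integral_abs (f := fun x => f x * g x) (μ := μ)
          linarith
      _ = ∫ x, 2 * |f x * g x| ∂μ := (integral_const_mul _ _).symm
      _ ≤ ∫ x, (t * f x ^ 2 + g x ^ 2 / t) ∂μ := by
          refine integral_mono (hfgi.abs.const_mul 2) ((hfi.const_mul t).add (hgi.div_const t)) fun x => ?_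
          exact two_mul_abs_mul_le ht (f x) (g x)
      _ = t * A + Bi / t := by
          rw [integral_add (hfi.const_mul t) (hgi.div_const t), integral_const_mul, integral_div]
  by_cases hA1 : A = 0
  · have hf0 : (fun x => f x ^ 2) =ᵐ[μ] 0 := (integral_eq_zero_iff_of_nonneg (fun x => sq_nonneg _) hfi).1 hA1
    have hfg0 : (fun x => f x * g x) =ᵐ[μ] 0 := hf0.mono fun x hx => by
      have : f x = 0 := pow_eq_zero_iff (n := 2) (by norm_num) |>.1 hx
      simp [this]
    rw [integral_congr_ae hfg0]
    simp only [Pi.zero_apply, integral_zero, abs_zero]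
    positivity
  by_cases hB1 : Bi = 0
  · have hg0 : (fun x => g x ^ 2) =ᵐ[μ] 0 := (integral_eq_zero_iff_of_nonneg (fun x => sq_nonneg _) hgi).1 hB1
    have hfg0 : (fun x => f x * g x) =ᵐ[μ] 0 := hg0.mono fun x hx => by
      have : g x = 0 := pow_eq_zero_iff (n := 2) (by norm_num) |>.1 hx
      simp [this]
    rw [integral_congr_ae hfg0]
    simp only [Pi.zero_apply, integral_zero, abs_zero]
    positivity
  have hApos : 0 < A := lt_of_le_of_ne hA0 (Ne.symm hA1)
  have hBpos : 0 < Bi := lt_of_le_of_ne hB0 (Ne.symm hB1)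
  have hsA : 0 < Real.sqrt A := Real.sqrt_pos.2 hApos
  have hsB : 0 < Real.sqrt Bi := Real.sqrt_pos.2 hBpos
  have h := hamgm (Real.sqrt Bi / Real.sqrt A) (div_pos hsB hsA)
  have hAA : A = Real.sqrt A * Real.sqrt A := (Real.mul_self_sqrt hA0).symm
  have hBB : Bi = Real.sqrt Bi * Real.sqrt Bi := (Real.mul_self_sqrt hB0).symm
  have e1 : Real.sqrt Bi / Real.sqrt A * A = Real.sqrt A * Real.sqrt Bi := by
    calc Real.sqrt Bi / Real.sqrt A * A = Real.sqrt Bi / Real.sqrt A * (Real.sqrt A * Real.sqrt A) := by rw [← hAA]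
      _ = Real.sqrt A * Real.sqrt Bi := by field_simp
  have e2 : Bi / (Real.sqrt Bi / Real.sqrt A) = Real.sqrt A * Real.sqrt Bi := by
    calc Bi / (Real.sqrt Bi / Real.sqrt A) = Real.sqrt Bi * Real.sqrt Bi / (Real.sqrt Bi / Real.sqrt A) := by
          rw [← hBB]
      _ = Real.sqrt A * Real.sqrt Bi := by field_simp
  rw [e1, e2] at h
  linarith

omit [DecidableEq ι] in
/-- **Weighted Cauchy–Schwarz**: `|∫ w f g| ≤ (∫ w f²)^{1/2} (∫ w g²)^{1/2}`, `w = e^{S}`. -/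
theorem abs_integral_exp_mul_mul_le {S : PSU ι N → ℝ} {f g : PSU ι N → ℝ} (hS : Continuous S) (hf : Continuous f)
    (hg : Continuous g) (μ : Measure (PSU ι N)) [IsFiniteMeasure μ] :
    |∫ x, Real.exp (S x) * (f x * g x) ∂μ| ≤
      Real.sqrt (∫ x, Real.exp (S x) * f x ^ 2 ∂μ) * Real.sqrt (∫ x, Real.exp (S x) * g x ^ 2 ∂μ) := by
  have hw : Continuous fun x => Real.sqrt (Real.exp (S x)) := Real.continuous_sqrt.comp (Real.continuous_exp.comp hS)
  have h := abs_integral_mul_le_sqrt (f := fun x => Real.sqrt (Real.exp (S x)) * f x)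
    (g := fun x => Real.sqrt (Real.exp (S x)) * g x) (hw.mul hf) (hw.mul hg) μ
  have e0 : (fun x => Real.exp (S x) * (f x * g x)) =
      fun x => Real.sqrt (Real.exp (S x)) * f x * (Real.sqrt (Real.exp (S x)) * g x) := by
    funext x
    linear_combination (-(f x * g x)) * SUNBakryEmery.sqrt_exp_mul_self (S x)
  have e1 : (fun x => Real.exp (S x) * f x ^ 2) = fun x => (Real.sqrt (Real.exp (S x)) * f x) ^ 2 := by
    funext x; rw [mul_pow, Real.sq_sqrt (Real.exp_pos _).le]
  have e2 : (fun x => Real.exp (S x) * g x ^ 2) = fun x => (Real.sqrt (Real.exp (S x)) * g x) ^ 2 := by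
    funext x; rw [mul_pow, Real.sq_sqrt (Real.exp_pos _).le]
  rw [e0, e1, e2]
  exact h

/-- **Weighted Cauchy–Schwarz for `Γ`**: `|∫ w Γ(u,v)| ≤ (∫ w Γ(u,u))^{1/2} (∫ w Γ(v,v))^{1/2}`. -/
theorem abs_integral_exp_mul_Gam_le {S u v : Cfg ι N → ℝ} (hS : ContDiff ℝ ∞ S)
    (hu : ContDiff ℝ ∞ u) (hv : ContDiff ℝ ∞ v) (μ : Measure (PSU ι N)) [IsFiniteMeasure μ] :
    |∫ g : PSU ι N, Real.exp (S (emb g)) * Gam u v (emb g) ∂μ| ≤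
      Real.sqrt (∫ g : PSU ι N, Real.exp (S (emb g)) * Gam u u (emb g) ∂μ) *
        Real.sqrt (∫ g : PSU ι N, Real.exp (S (emb g)) * Gam v v (emb g) ∂μ) := by
  have hSc := continuous_restrict hS
  have hwu : Continuous fun g : PSU ι N => Real.sqrt (Real.exp (S (emb g)) * Gam u u (emb g)) :=
    Real.continuous_sqrt.comp ((Real.continuous_exp.comp hSc).mul (continuous_restrict (contDiff_Gam hu hu)))
  have hwv : Continuous fun g : PSU ι N => Real.sqrt (Real.exp (S (emb g)) * Gam v v (emb g)) :=
    Real.continuous_sqrt.comp ((Real.continuous_exp.comp hSc).mul (continuous_restrict (contDiff_Gam hv hv)))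
  have h := abs_integral_mul_le_sqrt hwu hwv μ
  have hnu : ∀ g : PSU ι N, 0 ≤ Real.exp (S (emb g)) * Gam u u (emb g) := fun g =>
    mul_nonneg (Real.exp_pos _).le (Gam_self_nonneg _ _)
  have hnv : ∀ g : PSU ι N, 0 ≤ Real.exp (S (emb g)) * Gam v v (emb g) := fun g =>
    mul_nonneg (Real.exp_pos _).le (Gam_self_nonneg _ _)
  simp only [Real.sq_sqrt (hnu _), Real.sq_sqrt (hnv _)] at h
  refine le_trans ?_ ((le_abs_self _).trans h)
  calc |∫ g : PSU ι N, Real.exp (S (emb g)) * Gam u v (emb g) ∂μ|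
      ≤ ∫ g : PSU ι N, |Real.exp (S (emb g)) * Gam u v (emb g)| ∂μ := abs_integral_le_integral_abs
    _ ≤ ∫ g : PSU ι N, Real.sqrt (Real.exp (S (emb g)) * Gam u u (emb g)) *
          Real.sqrt (Real.exp (S (emb g)) * Gam v v (emb g)) ∂μ := by
        refine integral_mono (integrable_of_continuous_PSU ((Real.continuous_exp.comp hSc).mul
          (continuous_restrict (contDiff_Gam hu hv))).abs μ) (integrable_of_continuous_PSU (hwu.mul hwv) μ)
          fun g => ?_
        rw [← Real.sqrt_mul (hnu g), abs_mul, abs_of_pos (Real.exp_pos _)]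
        have hG := abs_Gam_le u v (emb g)
        rw [← Real.sqrt_mul (Gam_self_nonneg _ _)] at hG
        calc Real.exp (S (emb g)) * |Gam u v (emb g)|
            ≤ Real.exp (S (emb g)) * Real.sqrt (Gam u u (emb g) * Gam v v (emb g)) :=
              mul_le_mul_of_nonneg_left hG (Real.exp_pos _).le
          _ = Real.sqrt (Real.exp (S (emb g)) * Gam u u (emb g) * (Real.exp (S (emb g)) * Gam v v (emb g))) := by
              rw [show Real.exp (S (emb g)) * Gam u u (emb g) * (Real.exp (S (emb g)) * Gam v v (emb g)) =
                  (Real.exp (S (emb g))) ^ 2 * (Gam u u (emb g) * Gam v v (emb g)) by ring,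
                Real.sqrt_mul (sq_nonneg _), Real.sqrt_sq (Real.exp_pos _).le]

/-- **Poincaré inequality from approximate solvability of the Poisson equation** (the duality
argument replacing the spectral theorem): let `S` be smooth with `HessBound S Λ`, `K = N/2 - Λ > 0`,
`w = e^{S}`, `u` smooth, `m` a constant, and suppose there are smooth `v_k` with
`∫ w (L_S v_k - (u - m))² dσ^{⊗E} → 0`. Then `K ∫ w (u - m)² dσ^{⊗E} ≤ ∫ w Γ(u,u) dσ^{⊗E}`. -/
theorem poincare_of_approx (hN : N ≠ 0) {S : Cfg ι N → ℝ} (hS : ContDiff ℝ ∞ S) {Λ : ℝ} (hHess : HessBound S Λ)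
    (hK : 0 < (N : ℝ) / 2 - Λ) {u : Cfg ι N → ℝ} (hu : ContDiff ℝ ∞ u) (m : ℝ)
    (v : ℕ → Cfg ι N → ℝ) (hv : ∀ k, ContDiff ℝ ∞ (v k))
    (hconv : Tendsto (fun k => ∫ g : PSU ι N, Real.exp (S (emb g)) *
      (genL S (v k) (emb g) - (u (emb g) - m)) ^ 2 ∂(haarPi ι N)) atTop (𝓝 0)) :
    ((N : ℝ) / 2 - Λ) * ∫ g : PSU ι N, Real.exp (S (emb g)) * (u (emb g) - m) ^ 2 ∂(haarPi ι N) ≤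
      ∫ g : PSU ι N, Real.exp (S (emb g)) * Gam u u (emb g) ∂(haarPi ι N) := by
  set σ := haarPi ι N with hσ
  set K : ℝ := (N : ℝ) / 2 - Λ with hKdef
  have hSc : Continuous fun g : PSU ι N => S (emb g) := continuous_restrict hS
  have hu0 : ContDiff ℝ ∞ (fun Q => u Q - m) := hu.sub contDiff_const
  set A : ℝ := ∫ g : PSU ι N, Real.exp (S (emb g)) * (u (emb g) - m) ^ 2 ∂σ with hAdef
  set G : ℝ := ∫ g : PSU ι N, Real.exp (S (emb g)) * Gam u u (emb g) ∂σ with hGdef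
  set e : ℕ → ℝ := fun k => ∫ g : PSU ι N, Real.exp (S (emb g)) * (genL S (v k) (emb g) - (u (emb g) - m)) ^ 2 ∂σ
    with hedef
  have hA0 : 0 ≤ A := integral_nonneg fun g => mul_nonneg (Real.exp_pos _).le (sq_nonneg _)
  have hG0 : 0 ≤ G := integral_nonneg fun g => mul_nonneg (Real.exp_pos _).le (Gam_self_nonneg _ _)
  have he0 : ∀ k, 0 ≤ e k := fun k => integral_nonneg fun g => mul_nonneg (Real.exp_pos _).le (sq_nonneg _)
  change K * A ≤ G
  have hkey : ∀ k, A ≤ Real.sqrt (G / K) * (Real.sqrt A + Real.sqrt (e k)) + Real.sqrt A * Real.sqrt (e k) := by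
    intro k
    have hvk := hv k
    have hLc : Continuous fun g : PSU ι N => genL S (v k) (emb g) := continuous_restrict (contDiff_genL hS hvk)
    have huc : Continuous fun g : PSU ι N => u (emb g) - m := continuous_restrict hu0
    have hwc : Continuous fun g : PSU ι N => Real.exp (S (emb g)) := Real.continuous_exp.comp hSc
    have i1 : Integrable (fun g : PSU ι N => Real.exp (S (emb g)) * ((u (emb g) - m) * genL S (v k) (emb g))) σ :=
      integrable_of_continuous_PSU (hwc.mul (huc.mul hLc)) σ
    have i2 : Integrable (fun g : PSU ι N => Real.exp (S (emb g)) *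
        ((u (emb g) - m) * ((u (emb g) - m) - genL S (v k) (emb g)))) σ :=
      integrable_of_continuous_PSU (hwc.mul (huc.mul (huc.sub hLc))) σ
    have hsplit : A = ∫ g : PSU ι N, Real.exp (S (emb g)) * ((u (emb g) - m) * genL S (v k) (emb g)) ∂σ +
        ∫ g : PSU ι N, Real.exp (S (emb g)) * ((u (emb g) - m) * ((u (emb g) - m) - genL S (v k) (emb g))) ∂σ := by
      rw [← integral_add i1 i2]
      refine integral_congr_ae (ae_of_all _ fun g => ?_)
      ring
    have hstep2 : ∫ g : PSU ι N, Real.exp (S (emb g)) * ((u (emb g) - m) * genL S (v k) (emb g)) ∂σ =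
        -∫ g : PSU ι N, Real.exp (S (emb g)) * Gam u (v k) (emb g) ∂σ := by
      have h1 := integral_mul_exp_mul_genL hN hS hu hvk
      have h2 := integral_exp_mul_genL_eq_zero hN hS hvk
      have : ∫ g : PSU ι N, Real.exp (S (emb g)) * ((u (emb g) - m) * genL S (v k) (emb g)) ∂σ =
          ∫ g : PSU ι N, u (emb g) * (Real.exp (S (emb g)) * genL S (v k) (emb g)) ∂σ -
            m * ∫ g : PSU ι N, Real.exp (S (emb g)) * genL S (v k) (emb g) ∂σ := by
        have i3 : Integrable (fun g : PSU ι N => u (emb g) * (Real.exp (S (emb g)) * genL S (v k) (emb g))) σ :=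
          integrable_of_continuous_PSU ((continuous_restrict hu).mul (hwc.mul hLc)) σ
        have i4 : Integrable (fun g : PSU ι N => m * (Real.exp (S (emb g)) * genL S (v k) (emb g))) σ :=
          (integrable_of_continuous_PSU (hwc.mul hLc) σ).const_mul m
        rw [← integral_const_mul, ← integral_sub i3 i4]
        refine integral_congr_ae (ae_of_all _ fun g => ?_)
        ring
      rw [this, h1, h2, mul_zero, sub_zero]
    have hstep3 := abs_integral_exp_mul_Gam_le hS hu hvk σ
    have hstep4 : ∫ g : PSU ι N, Real.exp (S (emb g)) * Gam (v k) (v k) (emb g) ∂σ ≤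
        (1 / K) * ∫ g : PSU ι N, Real.exp (S (emb g)) * genL S (v k) (emb g) ^ 2 ∂σ := by
      have h := integral_exp_mul_Gam_le hN hS hHess hvk
      rw [← hKdef] at h
      rw [one_div, ← div_eq_inv_mul, le_div_iff₀ hK, mul_comm]
      exact h
    have hstep5 : |∫ g : PSU ι N, Real.exp (S (emb g)) *
        ((u (emb g) - m) * ((u (emb g) - m) - genL S (v k) (emb g))) ∂σ| ≤ Real.sqrt A * Real.sqrt (e k) := by
      have h := abs_integral_exp_mul_mul_le (f := fun g : PSU ι N => u (emb g) - m)
        (g := fun g : PSU ι N => (u (emb g) - m) - genL S (v k) (emb g)) hSc huc (huc.sub hLc) σ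
      have : ∫ g : PSU ι N, Real.exp (S (emb g)) * ((u (emb g) - m) - genL S (v k) (emb g)) ^ 2 ∂σ = e k := by
        simp only [hedef]
        refine integral_congr_ae (ae_of_all _ fun g => ?_)
        ring
      rwa [this] at h
    have hstep6 : ∫ g : PSU ι N, Real.exp (S (emb g)) * genL S (v k) (emb g) ^ 2 ∂σ ≤
        (Real.sqrt A + Real.sqrt (e k)) ^ 2 := by
      have hcs := abs_integral_exp_mul_mul_le (f := fun g : PSU ι N => u (emb g) - m)
        (g := fun g : PSU ι N => genL S (v k) (emb g) - (u (emb g) - m)) hSc huc (hLc.sub huc) σ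
      have hek : ∫ g : PSU ι N, Real.exp (S (emb g)) * (genL S (v k) (emb g) - (u (emb g) - m)) ^ 2 ∂σ = e k := rfl
      rw [hek] at hcs
      have hexp : ∫ g : PSU ι N, Real.exp (S (emb g)) * genL S (v k) (emb g) ^ 2 ∂σ =
          A + 2 * ∫ g : PSU ι N, Real.exp (S (emb g)) * ((u (emb g) - m) * (genL S (v k) (emb g) - (u (emb g) - m))) ∂σ +
            ∫ g : PSU ι N, Real.exp (S (emb g)) * (genL S (v k) (emb g) - (u (emb g) - m)) ^ 2 ∂σ := by
        have j1 : Integrable (fun g : PSU ι N => Real.exp (S (emb g)) * (u (emb g) - m) ^ 2) σ :=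
          integrable_of_continuous_PSU (hwc.mul (huc.pow 2)) σ
        have j2 : Integrable (fun g : PSU ι N => 2 * (Real.exp (S (emb g)) *
            ((u (emb g) - m) * (genL S (v k) (emb g) - (u (emb g) - m))))) σ :=
          (integrable_of_continuous_PSU (hwc.mul (huc.mul (hLc.sub huc))) σ).const_mul 2
        have j12 : Integrable (fun g : PSU ι N => Real.exp (S (emb g)) * (u (emb g) - m) ^ 2 +
            2 * (Real.exp (S (emb g)) * ((u (emb g) - m) * (genL S (v k) (emb g) - (u (emb g) - m))))) σ := j1.add j2
        have j3 : Integrable (fun g : PSU ι N => Real.exp (S (emb g)) * (genL S (v k) (emb g) - (u (emb g) - m)) ^ 2) σ :=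
          integrable_of_continuous_PSU (hwc.mul ((hLc.sub huc).pow 2)) σ
        rw [← integral_const_mul, hAdef, ← integral_add j1 j2, ← integral_add j12 j3]
        refine integral_congr_ae (ae_of_all _ fun g => ?_)
        ring
      have hek : ∫ g : PSU ι N, Real.exp (S (emb g)) * (genL S (v k) (emb g) - (u (emb g) - m)) ^ 2 ∂σ = e k := rfl
      rw [hexp, hek, add_sq, Real.sq_sqrt hA0, Real.sq_sqrt (he0 k)]
      have := (abs_le.1 hcs).2
      nlinarith
    have h34 : |∫ g : PSU ι N, Real.exp (S (emb g)) * Gam u (v k) (emb g) ∂σ| ≤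
        Real.sqrt G * Real.sqrt ((1 / K) * (Real.sqrt A + Real.sqrt (e k)) ^ 2) := by
      refine hstep3.trans (mul_le_mul_of_nonneg_left (Real.sqrt_le_sqrt (hstep4.trans ?_)) (Real.sqrt_nonneg _))
      exact mul_le_mul_of_nonneg_left hstep6 (by positivity)
    have hsqrt : Real.sqrt ((1 / K) * (Real.sqrt A + Real.sqrt (e k)) ^ 2) =
        Real.sqrt (1 / K) * (Real.sqrt A + Real.sqrt (e k)) := by
      rw [Real.sqrt_mul (by positivity), Real.sqrt_sq (by positivity)]
    rw [hsqrt] at h34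
    have hGK : Real.sqrt G * (Real.sqrt (1 / K) * (Real.sqrt A + Real.sqrt (e k))) =
        Real.sqrt (G / K) * (Real.sqrt A + Real.sqrt (e k)) := by
      rw [← mul_assoc, ← Real.sqrt_mul hG0, ← div_eq_mul_one_div]
    rw [hGK] at h34
    have h2' := (abs_le.1 h34).1
    have h5' := (abs_le.1 hstep5).2
    linarith [hsplit, hstep2, h2', h5']
  have hlim : Tendsto (fun k => Real.sqrt (G / K) * (Real.sqrt A + Real.sqrt (e k)) + Real.sqrt A * Real.sqrt (e k))
      atTop (𝓝 (Real.sqrt (G / K) * (Real.sqrt A + Real.sqrt 0) + Real.sqrt A * Real.sqrt 0)) := by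
    have hse : Tendsto (fun k => Real.sqrt (e k)) atTop (𝓝 (Real.sqrt 0)) :=
      (Real.continuous_sqrt.tendsto 0).comp hconv
    exact ((tendsto_const_nhds.add hse).const_mul _).add (hse.const_mul _)
  rw [Real.sqrt_zero, add_zero, mul_zero, add_zero] at hlim
  have hAle : A ≤ Real.sqrt (G / K) * Real.sqrt A := ge_of_tendsto' hlim hkey
  by_cases hA1 : Real.sqrt A = 0
  · have : A = 0 := by rwa [Real.sqrt_eq_zero hA0] at hA1
    rw [this, mul_zero]; exact hG0
  · have hsApos : 0 < Real.sqrt A := lt_of_le_of_ne (Real.sqrt_nonneg A) (Ne.symm hA1)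
    have h1 : Real.sqrt A * Real.sqrt A ≤ Real.sqrt (G / K) * Real.sqrt A := by rwa [Real.mul_self_sqrt hA0]
    have h2 : Real.sqrt A ≤ Real.sqrt (G / K) := le_of_mul_le_mul_right h1 hsApos
    have h3 : A ≤ G / K := by
      calc A = Real.sqrt A ^ 2 := (Real.sq_sqrt hA0).symm
        _ ≤ Real.sqrt (G / K) ^ 2 := pow_le_pow_left₀ (Real.sqrt_nonneg A) h2 2
        _ = G / K := Real.sq_sqrt (div_nonneg hG0 hK.le)
    rwa [le_div_iff₀ hK, mul_comm] at h3

end LatticeBakryEmery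

end Summit.Ventures.YMGap
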